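import Mathlib
import Summits.RiemannHypothesis.Statement
import Summits.RiemannHypothesis.RiemannHypothesis.Theorems.DeBrangesChainDefs
import Summits.RiemannHypothesis.RiemannHypothesis.Theorems.DeBrangesChainDoor
import Summits.RiemannHypothesis.RiemannHypothesis.Theorems.DeBrangesChainDoorWeilSign
import Literature.NumberTheory.LFunctions.SuzukiWeilHilbertSpaceDefs
import Literature.NumberTheory.LFunctions.SuzukiWeilHilbertSpace
import Literature.NumberTheory.LFunctions.SuzukiWeilOrthogonalSetProofs
import Literature.NumberTheory.LFunctions.SuzukiWeilKernelExpansionProofs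
import Literature.Analysis.UnboundedOperators.HilbertPolyaProofs
import HarnessLib
import HarnessLib.Audit

/-!
# RiemannHypothesis / COLUMN 6 (DBR) — the CONVERSE'S STATUS of the C2 residual `IsolatedV0` in the kernel

LINE 1 — LABEL: CONDITIONAL records (on two PRINTED RH-CONSEQUENCE structure facts of M. Suzuki,
*On the Hilbert space derived from the Weil distribution*, Canad. J. Math. (2025) =
arXiv:2301.00421v3, typed as named facts by the cell's module
`Literature/NumberTheory/LFunctions/SuzukiWeilHilbertSpace.lean`, dbl-t10 p422822:
`Suzuki2025_thm55_normIdentity` = CJM Thm. 5.5 (1) "RH ⟹ ‖ψ‖² = ½⟨ψ,ψ⟩_W on V(0)" and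
`Suzuki2025_orthogonalBasis` = CJM Prop. 4.1/(5.11) "RH ⟹ the orthogonal basis ψ_γ of V(0)") about
the DECLARED RESIDUAL `IsolatedV0` (RH-EQUIVALENT·PRINTED l.1; cell rh-crit/dbl; nobody's proving
target). bears_on: B-C/B-P (LADDER-RH §1 COLUMN 6 DBR). WHAT THIS IS NOT: not progress on RH; no
fact is discharged here; the two structure facts are the deep half of the printed equivalence (de
Branges-space theory, boundary facts F2/F3 of dbl/README §5) and stay NAMED FACTS; nothing here
bears on the truth of RH.

WHAT IS RECORDED (director's seat text: "label RH-EQUIVALENT on line 1; the converse's status stated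
explicitly" — here stated IN THE KERNEL):
* `suzuki2025_prop58_of_structureFacts` — CJM Prop. 5.8 (`Suzuki2025_prop58 : RH ↔ (1) ∧ (2)`)
  holds MODULO the two structure facts: its door hypothesis `hdoor` of
  `Literature.NumberTheory.LFunctions.Suzuki2025_prop58_of` is DISCHARGED by the kernel door
  `chainDoorV0_proof` (p419686), which Literature cannot import.
* `riemannHypothesis_iff_isolatedV0_of` — `RiemannHypothesis ↔ IsolatedV0` modulo the same two
  facts: direction ⟸ UNCONDITIONAL (the door), direction ⟹ CONDITIONAL (`isolatedV0_of_riemannHypothesis_of`).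
  So the residual's label reads, in kernel terms: RH-EQUIVALENT — ⟸ DERIVED, ⟹ PRINTED (two named
  RH-CONSEQUENCE facts).
* `riemannHypothesis_iff_weilSign_and_separation_of` — the minimal door's hypotheses
  (`Theorems/DeBrangesChainDoorWeilSign.lean`: Weil SIGN on `V(0)` ∧ `ZeroSeparationOn (suzukiV 0)`)
  are RH-EQUIVALENT modulo the same facts: no intermediate rung between them and `IsolatedV0`.
* `suzukiV_zero_ne_singleton_of_riemannHypothesis_of` — CJM Remark 5.2 "RH would be false if
  `V(0) = {0}`": `RH → V(0) ≠ {0}` modulo the basis fact, with t10's nonemptiness hypothesis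
  discharged by the tree's Hardy theorem (`infinite_riemannZetaNontrivialZeros`). Suzuki's question
  "`V(0) ≠ {0}` UNCONDITIONALLY?" (CJM §5, arXiv v1 p. 3 L41–44) stays OPEN in print, nobody's target.

UPDATE (dbl-iso g3, appended below): the fact `Suzuki2025_orthogonalBasis` is NO LONGER NEEDED for
the converse's condition (2) nor for Remark 5.2 — the cell's module
`Literature/NumberTheory/LFunctions/SuzukiWeilOrthogonalSetProofs.lean` PROVES, under the RH binder,
the orthogonal family `ψ_γ ∈ V(0)` with its printed values (CJM Prop. 4.1 / (4.2) / (5.11) minus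
completeness), hence `zeroSeparationOn_suzukiV_zero_of_riemannHypothesis : RH → ZeroSeparationOn (suzukiV 0)`
and `suzukiV_zero_ne_singleton_of_riemannHypothesis : RH → V(0) ≠ {0}` with NO named fact. The
converse's status of record becomes: `riemannHypothesis_iff_isolatedV0_of_normIdentity` —
`RiemannHypothesis ↔ IsolatedV0` CONDITIONAL ON ONE printed RH-CONSEQUENCE fact,
`Suzuki2025_thm55_normIdentity` (CJM Thm. 5.5 (1), the norm identity, whose printed proof needs the
COMPLETENESS of `{ψ_γ}` = de Branges' Thm. 22, boundary F2/F8). LABEL unchanged: RH-EQUIVALENT —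
⟸ DERIVED, ⟹ PRINTED (one named fact); nothing here bears on the truth of RH.
-/

noncomputable section

-- D-0017: `Summit.<S>.<S>.…` is the designed namespace of a single-problem summit.
set_option linter.dupNamespace false

namespace Summit.RiemannHypothesis.RiemannHypothesis.Theorems.DeBrangesChain

open Literature.NumberTheory.LFunctions MeasureTheory Complex Filter Set
open scoped ComplexConjugate Topology

/-- **CJM Prop. 5.8 modulo the two structure facts** (door discharged): from
`Suzuki2025_thm55_normIdentity` (RH ⟹ (1)) and `Suzuki2025_orthogonalBasis` (RH ⟹ basis ⟹ (2)),
the printed equivalence `Suzuki2025_prop58 : RH ↔ (1) ∧ (2)` follows, the sufficiency half being the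
kernel door `chainDoorV0_proof`. CONDITIONAL on two named RH-CONSEQUENCE facts; RH-EQUIVALENT
statement, nobody's target. [cite: Suzuki2025WeilHilbertSpace, CJM Prop. 5.8 p. 17 (= arXiv v1 Thm. 1.3 p. 3)] -/
theorem suzuki2025_prop58_of_structureFacts (h55 : Suzuki2025_thm55_normIdentity)
    (hB : Suzuki2025_orthogonalBasis) : Suzuki2025_prop58 :=
  Suzuki2025_prop58_of h55 hB fun h ↦ chainDoorV0_proof h

/-- **The converse direction, CONDITIONAL**: `RH → IsolatedV0` modulo `Suzuki2025_thm55_normIdentity`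
and `Suzuki2025_orthogonalBasis` (t10's `Suzuki2025_prop58_mp_of`, restated on the residual decl).
This is the converse's status of record: PRINTED (two named RH-CONSEQUENCE facts), not derived.
[cite: Suzuki2025WeilHilbertSpace, CJM Prop. 5.8 p. 17, proof of necessity (= arXiv v1 Thm. 1.2/1.3)] -/
theorem isolatedV0_of_riemannHypothesis_of (h55 : Suzuki2025_thm55_normIdentity)
    (hB : Suzuki2025_orthogonalBasis) (hRH : _root_.RiemannHypothesis) : IsolatedV0 :=
  Suzuki2025_prop58_mp_of h55 hB hRH

/-- **`RiemannHypothesis ↔ IsolatedV0` modulo the two structure facts** — the residual's label in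
kernel terms: ⟸ is the UNCONDITIONAL door `chainDoorV0_proof`; ⟹ is CONDITIONAL on
`Suzuki2025_thm55_normIdentity` ∧ `Suzuki2025_orthogonalBasis`. RH-EQUIVALENT·(⟸ DERIVED, ⟹ PRINTED).
[cite: Suzuki2025WeilHilbertSpace, CJM Prop. 5.8 p. 17 (= arXiv v1 Thm. 1.3 p. 3)] -/
theorem riemannHypothesis_iff_isolatedV0_of (h55 : Suzuki2025_thm55_normIdentity)
    (hB : Suzuki2025_orthogonalBasis) : _root_.RiemannHypothesis ↔ IsolatedV0 :=
  ⟨isolatedV0_of_riemannHypothesis_of h55 hB, fun h ↦ chainDoorV0_proof h⟩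

/-- **The minimal door's hypotheses are RH-EQUIVALENT modulo the same facts**: (Weil SIGN on `V(0)`:
every unconditional Weil sum of a compatible value assignment of a `ψ ∈ V(0)` has `Re ≥ 0`) ∧
`ZeroSeparationOn (suzukiV 0)` ↔ RH — ⟸ is `chainDoorV0_of_weilSum_re_nonneg` (unconditional), ⟹
goes through (1) (`weilSum_re_nonneg_of_weilNormIdentityOn`) and the basis
(`zeroSeparationOn_of_orthogonalBasis`). Hence NO intermediate rung between the sign form and
`IsolatedV0` (label bookkeeping of `Theorems/DeBrangesChainDoorWeilSign.lean`, now in the kernel).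
[cite: Suzuki2025WeilHilbertSpace, CJM Prop. 5.8 p. 17 (= arXiv v1 Thm. 1.3 p. 3)] -/
theorem riemannHypothesis_iff_weilSign_and_separation_of (h55 : Suzuki2025_thm55_normIdentity)
    (hB : Suzuki2025_orthogonalBasis) :
    _root_.RiemannHypothesis ↔
      ((∀ ψ ∈ suzukiV 0, ∀ c : ℂ → ℂ,
          (∀ ρ ∈ ZetaZeros.riemannZetaNontrivialZeros,
              HasHatValue ψ (suzukiZeroParam ρ) (c (suzukiZeroParam ρ))) →
            ∀ S : ℂ, HasSum (fun ρ : ZetaZeros.riemannZetaNontrivialZeros ↦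
                (riemannZetaZeroOrder (ρ : ℂ) : ℂ) * c (suzukiZeroParam ρ) *
                  conj (c (conj (suzukiZeroParam ρ)))) S → 0 ≤ S.re) ∧
        ZeroSeparationOn (suzukiV 0)) :=
  ⟨fun hRH ↦ ⟨weilSum_re_nonneg_of_weilNormIdentityOn (h55 hRH),
      zeroSeparationOn_of_orthogonalBasis hB hRH⟩,
    fun h ↦ chainDoorV0_of_weilSum_re_nonneg h.1 h.2⟩

/-- **CJM Remark 5.2, "the RH would be false if `V(0) = {0}`"**: `RH → V(0) ≠ {0}` modulo the basis
fact, with the nonemptiness of the zero set DISCHARGED by the tree (Hardy: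
`Literature.Analysis.UnboundedOperators.infinite_riemannZetaNontrivialZeros`) — t10's
`suzukiV_zero_ne_singleton_of_basis` without its `hne` hypothesis. CONDITIONAL on
`Suzuki2025_orthogonalBasis`; Suzuki's UNCONDITIONAL question stays open in print.
[cite: Suzuki2025WeilHilbertSpace, CJM Remark 5.2 p. 14 (= arXiv v1 p. 3 L41–44)] -/
theorem suzukiV_zero_ne_singleton_of_riemannHypothesis_of (hB : Suzuki2025_orthogonalBasis)
    (hRH : _root_.RiemannHypothesis) : suzukiV 0 ≠ {0} :=
  suzukiV_zero_ne_singleton_of_basis hB hRH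
    Literature.Analysis.UnboundedOperators.infinite_riemannZetaNontrivialZeros.nonempty

/-! ## Appended (dbl-iso g3): the converse modulo ONE fact — condition (2) and Remark 5.2 are now kernel theorems -/

/-- **The converse direction, CONDITIONAL ON ONE FACT**: `RH → IsolatedV0` modulo
`Suzuki2025_thm55_normIdentity` alone — condition (2) (`ZeroSeparationOn (suzukiV 0)`) under RH is the
kernel theorem `zeroSeparationOn_suzukiV_zero_of_riemannHypothesis` (the orthogonal family `ψ_γ ∈ V(0)`
with the printed values, `SuzukiWeilOrthogonalSetProofs.lean`). RH-CONSEQUENCE modulo one named fact.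
[cite: Suzuki2025WeilHilbertSpace, CJM Prop. 5.8 p. 17, proof of necessity (= arXiv v1 Thm. 1.2/1.3)] -/
theorem isolatedV0_of_riemannHypothesis_of_normIdentity (h55 : Suzuki2025_thm55_normIdentity)
    (hRH : _root_.RiemannHypothesis) : IsolatedV0 :=
  ⟨h55 hRH, zeroSeparationOn_suzukiV_zero_of_riemannHypothesis hRH⟩

/-- **`RiemannHypothesis ↔ IsolatedV0` modulo ONE structure fact** — the residual's label in kernel
terms, sharpened: ⟸ is the UNCONDITIONAL door `chainDoorV0_proof`; ⟹ is CONDITIONAL on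
`Suzuki2025_thm55_normIdentity` only (CJM Thm. 5.5 (1): RH ⟹ `‖ψ‖² = ½⟨ψ,ψ⟩_W` on `V(0)`, whose
printed proof uses the COMPLETENESS of `{ψ_γ}` — de Branges' Thm. 22, boundary F2/F8 — the one input
not formalised). RH-EQUIVALENT·(⟸ DERIVED, ⟹ PRINTED modulo one named fact).
[cite: Suzuki2025WeilHilbertSpace, CJM Prop. 5.8 p. 17 (= arXiv v1 Thm. 1.3 p. 3)] -/
theorem riemannHypothesis_iff_isolatedV0_of_normIdentity (h55 : Suzuki2025_thm55_normIdentity) :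
    _root_.RiemannHypothesis ↔ IsolatedV0 :=
  ⟨isolatedV0_of_riemannHypothesis_of_normIdentity h55, fun h ↦ chainDoorV0_proof h⟩

/-- **CJM Prop. 5.8 (`Suzuki2025_prop58 : RH ↔ (1) ∧ (2)`) modulo ONE fact**: sufficiency is the kernel
door, necessity of (2) is a kernel theorem, necessity of (1) is the named fact
`Suzuki2025_thm55_normIdentity`. [cite: Suzuki2025WeilHilbertSpace, CJM Prop. 5.8 p. 17 (TeX l.1953–1999)] -/
theorem suzuki2025_prop58_of_normIdentity (h55 : Suzuki2025_thm55_normIdentity) : Suzuki2025_prop58 :=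
  ⟨fun hRH ↦ ⟨h55 hRH, zeroSeparationOn_suzukiV_zero_of_riemannHypothesis hRH⟩,
    fun h ↦ chainDoorV0_proof h⟩

/-- **The minimal door's hypotheses are RH-EQUIVALENT modulo the ONE fact**: (Weil SIGN on `V(0)`) ∧
`ZeroSeparationOn (suzukiV 0)` ↔ RH, the separation conjunct under RH being a kernel theorem now.
[cite: Suzuki2025WeilHilbertSpace, CJM Prop. 5.8 p. 17 (= arXiv v1 Thm. 1.3 p. 3)] -/
theorem riemannHypothesis_iff_weilSign_and_separation_of_normIdentity
    (h55 : Suzuki2025_thm55_normIdentity) :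
    _root_.RiemannHypothesis ↔
      ((∀ ψ ∈ suzukiV 0, ∀ c : ℂ → ℂ,
          (∀ ρ ∈ ZetaZeros.riemannZetaNontrivialZeros,
              HasHatValue ψ (suzukiZeroParam ρ) (c (suzukiZeroParam ρ))) →
            ∀ S : ℂ, HasSum (fun ρ : ZetaZeros.riemannZetaNontrivialZeros ↦
                (riemannZetaZeroOrder (ρ : ℂ) : ℂ) * c (suzukiZeroParam ρ) *
                  conj (c (conj (suzukiZeroParam ρ)))) S → 0 ≤ S.re) ∧
        ZeroSeparationOn (suzukiV 0)) :=
  ⟨fun hRH ↦ ⟨weilSum_re_nonneg_of_weilNormIdentityOn (h55 hRH),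
      zeroSeparationOn_suzukiV_zero_of_riemannHypothesis hRH⟩,
    fun h ↦ chainDoorV0_of_weilSum_re_nonneg h.1 h.2⟩

/-- **Under RH the separation condition (2) holds and `V(0) ≠ {0}` — with NO named fact** (Summits-side
record of the Literature theorems `zeroSeparationOn_suzukiV_zero_of_riemannHypothesis` and
`suzukiV_zero_ne_singleton_of_riemannHypothesis`; CJM Prop. 5.8 ⟹ (2) and Remark 5.2). RH-CONSEQUENCE,
PROVED. [cite: Suzuki2025WeilHilbertSpace, CJM Prop. 5.8 p. 17 and Remark 5.2 p. 14] -/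
theorem zeroSeparation_and_ne_singleton_of_riemannHypothesis (hRH : _root_.RiemannHypothesis) :
    ZeroSeparationOn (suzukiV 0) ∧ suzukiV 0 ≠ {0} :=
  ⟨zeroSeparationOn_suzukiV_zero_of_riemannHypothesis hRH,
    suzukiV_zero_ne_singleton_of_riemannHypothesis hRH⟩

/-! ## Appended (dbl-iso g4): the residual is RH-EQUIVALENT·DERIVED — `RiemannHypothesis ↔ IsolatedV0` with NO named fact

LINE 1 — LABEL: RH-EQUIVALENT·DERIVED: an equivalence PROVED AS AN EQUIVALENCE (kernel both ways).
WHAT THIS IS NOT: not evidence for either side of RH; an RH-equivalence becoming a tree theorem in both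
directions re-indexes RH through Suzuki's door, it moves RH by nothing; nothing here bears on the truth
of RH. bears_on: B-C/B-P (LADDER-RH §1 COLUMN 6 DBR).

The one remaining named fact of the converse, `Suzuki2025_thm55_normIdentity` (CJM Thm. 5.5 (1)), is
now the tree theorem `Literature.NumberTheory.LFunctions.Suzuki2025_thm55_normIdentity_holds`
(`Literature/NumberTheory/LFunctions/SuzukiWeilKernelExpansionProofs.lean`, dbl-t10 p444739: the
orthogonal basis `{ψ_γ}` of `V(0)` is COMPLETE via the kernel expansion `K_w ∈ closure span{𝖥ψ_γ}` from
the Hadamard partial fraction of `ξ′/ξ` — de Branges' Thm. 22 content — whence the norm identity). The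
records below are the hypothesis-free specialisations of the `_of_normIdentity` theorems above, so that
the residual's status of record has DECL NAMES, not terms:
* `isolatedV0_of_riemannHypothesis : RiemannHypothesis → IsolatedV0` (CJM Prop. 5.8, necessity);
* `riemannHypothesis_iff_isolatedV0 : RiemannHypothesis ↔ IsolatedV0` (CJM Prop. 5.8 on the residual decl);
* `Suzuki2025_prop58_holds : Suzuki2025_prop58` — the Literature fact CJM Prop. 5.8 `RH ↔ (1) ∧ (2)`
  DISCHARGED here (Summits side, because its sufficiency half is the door `chainDoorV0_proof`, which a
  Literature module cannot import);
* `riemannHypothesis_iff_weilSign_and_separation` — the minimal door's hypotheses (Weil SIGN on `V(0)` ∧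
  `ZeroSeparationOn (suzukiV 0)`) are RH-EQUIVALENT, hypothesis-free;
* `weilNormIdentityOn_suzukiV_zero_of_riemannHypothesis` — condition (1) alone under RH, restated on the
  Summits side next to condition (2) (`zeroSeparation_and_ne_singleton_of_riemannHypothesis`).
Door `chainDoorV0_proof` and the residual decl `IsolatedV0` are unchanged; NO ROUTE is unchanged.
-/

/-- **Condition (1) of CJM Prop. 5.8 under RH, NO named fact**: `RH → WeilNormIdentityOn (suzukiV 0)`
(`‖ψ‖² = ½⟨ψ,ψ⟩_W` on `V(0)`) — Summits-side record of the Literature theorem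
`Suzuki2025_thm55_normIdentity_holds` (CJM Thm. 5.5 (1), dbl-t10 p444739). RH-CONSEQUENCE, PROVED.
[cite: Suzuki2025WeilHilbertSpace, CJM Thm. 5.5 (1) p. 16 and Prop. 5.8 p. 17] -/
theorem weilNormIdentityOn_suzukiV_zero_of_riemannHypothesis (hRH : _root_.RiemannHypothesis) :
    WeilNormIdentityOn (suzukiV 0) :=
  Suzuki2025_thm55_normIdentity_holds hRH

/-- **The converse direction, PROVED**: `RiemannHypothesis → IsolatedV0` with NO named fact (CJM Prop. 5.8,
necessity: (1) by `Suzuki2025_thm55_normIdentity_holds`, (2) by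
`zeroSeparationOn_suzukiV_zero_of_riemannHypothesis`). RH-CONSEQUENCE, PROVED — the converse's status of
record is now DERIVED. [cite: Suzuki2025WeilHilbertSpace, CJM Prop. 5.8 p. 17, proof of necessity
(= arXiv v1 Thm. 1.2/1.3 p. 3)] -/
theorem isolatedV0_of_riemannHypothesis (hRH : _root_.RiemannHypothesis) : IsolatedV0 :=
  isolatedV0_of_riemannHypothesis_of_normIdentity Suzuki2025_thm55_normIdentity_holds hRH

/-- **`RiemannHypothesis ↔ IsolatedV0`, hypothesis-free — the C2 residual is RH-EQUIVALENT·DERIVED.**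
LINE 1 — LABEL: RH-EQUIVALENT·DERIVED: an equivalence PROVED AS AN EQUIVALENCE; ⟸ is the door
`chainDoorV0_proof` (Weil's criterion through Suzuki's `V(0)`), ⟹ is `isolatedV0_of_riemannHypothesis`
(CJM Thm. 5.5 (1) + Prop. 4.1/(5.11), all tree theorems). WHAT THIS IS NOT: not evidence for either side
of RH — it fixes, in the kernel, WHICH identity-plus-separation statement on `V(0)` is the Riemann
Hypothesis; nothing here bears on the truth of RH.
[cite: Suzuki2025WeilHilbertSpace, CJM Prop. 5.8 p. 17 (= arXiv v1 Thm. 1.3 p. 3)] -/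
theorem riemannHypothesis_iff_isolatedV0 : _root_.RiemannHypothesis ↔ IsolatedV0 :=
  riemannHypothesis_iff_isolatedV0_of_normIdentity Suzuki2025_thm55_normIdentity_holds

/-- **Discharge of the Literature fact `Suzuki2025_prop58`** (CJM Prop. 5.8: `RH ↔ (1) ∧ (2)` on `V(0)`),
hypothesis-free: necessity by `Suzuki2025_thm55_normIdentity_holds` and
`zeroSeparationOn_suzukiV_zero_of_riemannHypothesis`, sufficiency by the kernel door `chainDoorV0_proof`
(which lives under `Summits/`, hence the discharge is recorded here and not in a Literature module).
RH-EQUIVALENT statement PROVED AS AN EQUIVALENCE; nothing here bears on the truth of RH.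
[cite: Suzuki2025WeilHilbertSpace, CJM Prop. 5.8 p. 17 (TeX l.1953–1999; = arXiv v1 Thm. 1.3 p. 3)] -/
theorem Suzuki2025_prop58_holds : Suzuki2025_prop58 :=
  suzuki2025_prop58_of_normIdentity Suzuki2025_thm55_normIdentity_holds

/-- **The minimal door's hypotheses are RH-EQUIVALENT, hypothesis-free**: (Weil SIGN on `V(0)`: every
unconditional Weil sum of a compatible value assignment of a `ψ ∈ V(0)` has `Re ≥ 0`) ∧
`ZeroSeparationOn (suzukiV 0)` ↔ RH. ⟸ is `chainDoorV0_of_weilSum_re_nonneg`; ⟹ goes through (1)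
(`Suzuki2025_thm55_normIdentity_holds`, `weilSum_re_nonneg_of_weilNormIdentityOn`) and the kernel
separation theorem. So there is NO intermediate rung between the sign form and `IsolatedV0`, now as a
hypothesis-free kernel statement. RH-EQUIVALENT·DERIVED; nothing here bears on the truth of RH.
[cite: Suzuki2025WeilHilbertSpace, CJM Prop. 5.8 p. 17 (= arXiv v1 Thm. 1.3 p. 3)] -/
theorem riemannHypothesis_iff_weilSign_and_separation :
    _root_.RiemannHypothesis ↔
      ((∀ ψ ∈ suzukiV 0, ∀ c : ℂ → ℂ,
          (∀ ρ ∈ ZetaZeros.riemannZetaNontrivialZeros,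
              HasHatValue ψ (suzukiZeroParam ρ) (c (suzukiZeroParam ρ))) →
            ∀ S : ℂ, HasSum (fun ρ : ZetaZeros.riemannZetaNontrivialZeros ↦
                (riemannZetaZeroOrder (ρ : ℂ) : ℂ) * c (suzukiZeroParam ρ) *
                  conj (c (conj (suzukiZeroParam ρ)))) S → 0 ≤ S.re) ∧
        ZeroSeparationOn (suzukiV 0)) :=
  riemannHypothesis_iff_weilSign_and_separation_of_normIdentity Suzuki2025_thm55_normIdentity_holds

/-- **`IsolatedV0 ↔ ((1) ∧ (2) on V(0))` is definitional; recorded as the `Iff` between the residual decl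
and the right-hand side of the Literature fact `Suzuki2025_prop58`**, so that importers can move between
the Summits-side residual and the Literature-side printed statement without unfolding. RH-FREE
bookkeeping. [cite: Suzuki2025WeilHilbertSpace, CJM Prop. 5.8 p. 17] -/
theorem isolatedV0_iff : IsolatedV0 ↔ WeilNormIdentityOn (suzukiV 0) ∧ ZeroSeparationOn (suzukiV 0) :=
  Iff.rfl

end Summit.RiemannHypothesis.RiemannHypothesis.Theorems.DeBrangesChain

end
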